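import Summits.Ventures.PercRepro.RankDistNullityGirth
import Summits.Ventures.PercRepro.RankDistUpSetGirthEq

/-!
# PercRepro — THE EQUALITY LOCUS OF THEOREM G* (the dual of Theorem G-EQ): the nullity level `ν_j` equals the
upper binomial coefficient `C(n, p + j)` iff every cocircuit has more than `n − p − j + 1` elements (p9, gen 22)

`RankDistNullityGirth` (Theorem G*): in a finite matroid on `n` elements of rank `p` whose cocircuits all have at
least `g` elements, `C(n, p + j) ≤ ν_j = #{C ⊆ E : |C| − ρ(C) = j}` for `j ≤ q = n − p` with `q ≤ 2j + g` — Theorem G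
for the dual `M✶` at the level `u = q − j`, through `levelCount_dual_eq_nullityCount`. `RankDistUpSetGirthEq`
(Theorem G-EQ) characterises the equality of Theorem G in the strict range. Dualising it:
* `nullityCount_eq_choose_of_cocircuits`: if every cocircuit has at least `q − j + 2` elements then
  `ν_j = C(n, p + j)` (no range);
* `choose_lt_nullityCount_of_cogirth`: in the strict range `q + 1 ≤ 2j + g`, `C(n, p + j) < ν_j` as soon as some
  cocircuit has at most `q − j + 1` elements;
* **`nullityCount_eq_choose_iff_of_cogirth`: for `j ≤ q` with `q + 1 ≤ 2j + g`, `ν_j = C(n, p + j)` iff every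
  cocircuit of `M` has at least `q − j + 2` elements.**
Nothing here moves any window of the crux.
-/

namespace PercRepro.RankDist

open Set Finset _root_.Matroid PercRepro.ThmH

variable {α : Type} (M : Matroid α) [M.Finite]

/-- `p ≤ n` for a matroid of rank `p` on `n` elements. -/
lemma rank_le_card_gr {n p : ℕ} (hn : (gr M).card = n) (hr : M.eRank = (p : ℕ∞)) : p ≤ n := by
  have h := Matroid.eRank_add_eRank_dual M
  rw [hr, ← coe_gr, Set.encard_coe_eq_coe_finsetCard, hn] at h
  have h' : (p : ℕ∞) ≤ (n : ℕ∞) := by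
    rw [← h]
    exact le_self_add
  exact_mod_cast h'

omit [M.Finite] in
/-- The circuits of the dual are the cocircuits: a lower bound on the cocircuit sizes is a lower bound on the
circuit sizes of `M✶`. -/
lemma forall_isCircuit_dual_of_cocircuits {g : ℕ} (hg : ∀ K, M.IsCocircuit K → (g : ℕ∞) ≤ K.encard) :
    ∀ C, M✶.IsCircuit C → (g : ℕ∞) ≤ C.encard :=
  fun C hC => hg C (Matroid.isCocircuit_def.2 hC)

omit [M.Finite] in
/-- Conversely, a lower bound on the circuit sizes of `M✶` is one on the cocircuit sizes of `M`. -/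
lemma forall_isCocircuit_of_circuits_dual {g : ℕ} (hg : ∀ C, M✶.IsCircuit C → (g : ℕ∞) ≤ C.encard) :
    ∀ K, M.IsCocircuit K → (g : ℕ∞) ≤ K.encard :=
  fun K hK => hg K (Matroid.isCocircuit_def.1 hK)

/-- The nullity level `ν_j` of `M` is the rank level `q − j` of `M✶`, and `C(n, p + j) = C(n, q − j)`. -/
lemma nullityCount_eq_levelCount_dual {n p j : ℕ} (hn : (gr M).card = n) (hr : M.eRank = (p : ℕ∞))
    (hj : j ≤ n - p) : nullityCount M j = levelCount M✶ (n - p - j) := by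
  rw [levelCount_dual_eq_nullityCount M hn hr (by omega)]
  congr 1
  omega

/-- **`ν_j = C(n, p + j)` whenever every cocircuit has at least `q − j + 2` elements** (`q = n − p`, `j ≤ q`; no
range): the dual of `levelCount_eq_choose_of_circuits`. -/
theorem nullityCount_eq_choose_of_cocircuits {n p j : ℕ} (hn : (gr M).card = n) (hr : M.eRank = (p : ℕ∞))
    (hj : j ≤ n - p) (hK : ∀ K, M.IsCocircuit K → ((n - p - j + 2 : ℕ) : ℕ∞) ≤ K.encard) :
    nullityCount M j = n.choose (p + j) := by
  have hpn := rank_le_card_gr M hn hr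
  have hgr : (gr M✶).card = n := hn
  rw [nullityCount_eq_levelCount_dual M hn hr hj,
    levelCount_eq_choose_of_circuits M✶ (forall_isCircuit_dual_of_cocircuits M hK), hgr,
    ← Nat.choose_symm (by omega : p + j ≤ n)]
  congr 1
  omega

/-- **`C(n, p + j) < ν_j` in the strict range as soon as some cocircuit has at most `q − j + 1` elements**
(`j ≤ q = n − p`, `q + 1 ≤ 2j + g`, every cocircuit with at least `g` elements). -/
theorem choose_lt_nullityCount_of_cogirth {n p g j : ℕ} (hn : (gr M).card = n) (hr : M.eRank = (p : ℕ∞))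
    (hg : ∀ K, M.IsCocircuit K → (g : ℕ∞) ≤ K.encard) (hj : j ≤ n - p) (h2 : n - p + 1 ≤ 2 * j + g)
    {K : Set α} (hK : M.IsCocircuit K) (hKj : K.encard ≤ n - p - j + 1) :
    n.choose (p + j) < nullityCount M j := by
  have hpn := rank_le_card_gr M hn hr
  have hr' := eRank_dual_eq M hn hr
  have hgr : (gr M✶).card = n := hn
  have h := choose_lt_levelCount_of_girth M✶ hr' (forall_isCircuit_dual_of_cocircuits M hg) (u := n - p - j)
    (by omega) (by omega) (Matroid.isCocircuit_def.1 hK) hKj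
  rw [hgr, ← nullityCount_eq_levelCount_dual M hn hr hj] at h
  have hsymm : n.choose (p + j) = n.choose (n - p - j) := by
    rw [← Nat.choose_symm (by omega : p + j ≤ n)]
    congr 1
    omega
  rw [hsymm]
  exact h

/-- **THE EQUALITY LOCUS OF THEOREM G***: `j ≤ q = n − p`, `q + 1 ≤ 2j + g`, every cocircuit with at least `g`
elements — `ν_j = C(n, p + j)` iff every cocircuit of `M` has at least `q − j + 2` elements. -/
theorem nullityCount_eq_choose_iff_of_cogirth {n p g j : ℕ} (hn : (gr M).card = n) (hr : M.eRank = (p : ℕ∞))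
    (hg : ∀ K, M.IsCocircuit K → (g : ℕ∞) ≤ K.encard) (hj : j ≤ n - p) (h2 : n - p + 1 ≤ 2 * j + g) :
    nullityCount M j = n.choose (p + j) ↔
      ∀ K, M.IsCocircuit K → ((n - p - j + 2 : ℕ) : ℕ∞) ≤ K.encard := by
  have hpn := rank_le_card_gr M hn hr
  have hr' := eRank_dual_eq M hn hr
  have hgr : (gr M✶).card = n := hn
  have hiff := levelCount_eq_choose_iff_of_girth M✶ hr' (forall_isCircuit_dual_of_cocircuits M hg)
    (u := n - p - j) (by omega) (by omega)
  rw [hgr, ← nullityCount_eq_levelCount_dual M hn hr hj] at hiff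
  have hsymm : n.choose (p + j) = n.choose (n - p - j) := by
    rw [← Nat.choose_symm (by omega : p + j ≤ n)]
    congr 1
    omega
  rw [hsymm, hiff]

end PercRepro.RankDist
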